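import Literature.Probability.Percolation.ArmSeparationInSepFour
import Literature.Probability.Percolation.ArmSeparationOutLandingFour
import HarnessLib

/-!
# The four-arm inner landing step at density `p`: moves, Lemma 13, and the sum over slots

Topic `Literature/Probability/Percolation`; family `crit-perc` / near-critical percolation on `𝕋`.
A brick of the near-critical arm-separation theorem for four arms of alternating colours
(P. Nolin, *Near-critical percolation in two dimensions*, EJP 13 (2008), Thm. 11 for `j = 4`,
`σ = BWBW` [arXiv 0711.4948: Thm. 10]; H. Kesten, CMP 109 (1987), Lemmas 4–6), landing step of the
INTERNAL extremities at an arbitrary density `p` (Nolin 2008, §4.4, p. 13, with Prop. 12 (i)/(iii)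
and Lemma 13 [arXiv Prop. 11, Lemma 12], "for any product measure `P̂`"). The inner twin of
`ArmSeparationOutLandingFour.lean`, for the slots of `ArmSeparationInSlotsFour.lean` (supports
disjoint by `ArmSeparationInSepFour.lean`):

* `real_icorrEvent4_ge_at` — RSW–Harris lower bound for the inner corridor at any density `q`;
* `sepFourArmG n N q` — **the output event**: for each landing index `e`, the colour-read
  configuration framed by `ts e` carries a landed arm with inner end on the right side of `∂Λ_n` and
  outer end on the side `q` (`sepArmGen n N q`, `ArmSeparationInMoveFour.lean`); `q = 0` for an
  untwisted slot (inner and outer landing sides agree) and `q = 3` for a twisted one (opposite);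
* `InSlot4.move` — **the move**: on the four arm events and the four corridor events of a routed
  slot in range, `ω ∈ sepFourArmG n N (if tw then 3 else 0)` (`landing_move_gen`,
  `landing_move_gen_two` in the four reading configurations);
* `InSlot4.real_arms_le` — **Nolin's Lemma 13 per slot** at density `p`
  (`triSitePercolation_locallyMonotone_fkg`), and `real_biUnion_arms_le_in` — the sum over routed slots.

Everything here is proved; no named facts are introduced.

## References

* P. Nolin, Near-critical percolation in two dimensions, *Electron. J. Probab.* 13 (2008), §4.3
  Prop. 12, Lemma 13, §4.4 (arXiv 0711.4948: Prop. 11, Lemma 12, proof of Thm. 10, p. 13) [Nolin2008].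
* H. Kesten, Scaling relations for 2D-percolation, *Comm. Math. Phys.* 109 (1987), Lemma 2, §2 [Kesten1987].
-/

noncomputable section

open Set MeasureTheory

namespace Literature.Probability.Percolation

open LatticeModels Tube

/-! ### RSW–Harris lower bound for the inner corridor at density `q` -/

/-- Exit-run arithmetic: `(d + 1) s ≤ n/64 + 4 s` and `n/64 + 2 s ≤ d s` for `d = n/64/s + 3` (`1 ≤ s`). [folklore] -/
theorem LParams.d_mul_facts (P : LParams) (hs : 1 ≤ P.s) : (P.d + 1) * P.s ≤ P.n / 64 + 4 * P.s ∧ P.n / 64 + 2 * P.s ≤ P.d * P.s := by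
  unfold LParams.d
  have h1 := Nat.div_mul_le_self (P.n / 64) P.s
  have h2 := Nat.lt_div_mul_add (a := P.n / 64) hs
  constructor <;> nlinarith

/-- **The four-arm inner corridor has probability at least `c_F c^(B+3)` at density `q`** (beacon,
spoke, arc, approach tube, target free space: Harris four times), with the crossing hypothesis capped
at short sides `≤ Ncap` (`2ε, 2e, n/64, n/8 - 2 ≤ Ncap`). [cite: Nolin2008, §4.3 Prop. 12 (proof) (arXiv 0711.4948: Prop. 11)] -/
theorem real_icorrEvent4_ge_at (q : unitInterval) {cF c : ℝ} {ρ Ncap : ℕ}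
    (hF : ∀ (z : Site 2) (k : ℕ), 1 ≤ k → k ≤ Ncap → cF ≤ (triSitePercolation q).real (triFrameAt z k))
    (hrsw : ∀ n : ℕ, 1 ≤ ⌊(ρ : ℝ) * n⌋₊ → n ≤ Ncap → c ≤ triLRCrossingProb q ⌊(ρ : ℝ) * n⌋₊ n) (hρ : 4 ≤ ρ) (hc : 0 ≤ c)
    {i m n k : ℕ} (hk : 2 ≤ k) (hkcap : k / 2 ≤ Ncap) {T₀ : ℤ} {w L ε r e s a len B bs : ℕ} {t : ℤ} {W : ℕ}
    (hε : 1 ≤ ε) (hεcap : 2 * ε ≤ Ncap) (hsp : L + k / 4 ≤ ρ * (2 * ε)) (he : 1 ≤ e) (hecap : 2 * e ≤ Ncap) (hse : s + 2 * e ≤ 4 * (2 * e))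
    (hrs : 1 ≤ r / s)
    (hn : 1 ≤ n / 64) (hncap : n / 64 ≤ Ncap) (hW : W ≤ ρ * (n / 64)) (hV : 2 * (n / 64) ≤ ρ * (n / 8 - 2)) (hV' : 1 ≤ n / 8 - 2)
    (hVcap : n / 8 - 2 ≤ Ncap) (hlen : (arc (thinRing r e s) a len).length ≤ B) :
    cF * c ^ (B + 3) ≤ (triSitePercolation q).real (icorrEvent4 i m n k T₀ w L ε r e s a len bs t W) := by
  have hρ1 : 1 ≤ ρ := le_trans (by norm_num) hρ
  have hc1 : c ≤ 1 := by
    have h := hrsw 1 (by rw [Nat.cast_one, mul_one, Nat.floor_natCast]; exact hρ1) (le_trans hε (by omega))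
    exact h.trans measureReal_le_one
  set E1 := bcnEvent i m k T₀ w with hE1
  set E2 := spokeEvent i m k T₀ w L ε with hE2
  set E3 := eventAll (arc (thinRing r e s) a len) with hE3
  set E4 : Set (SiteConfig (Site 2)) := {χ | frameConfig bs χ ∈ tgtH n t W} with hE4
  set E5 : Set (SiteConfig (Site 2)) := {χ | frameConfig bs χ ∈ tgtV n t} with hE5
  have d1 : DeterminedBy E1 ↑((triSqAnnulusFinset (bcnCentre m k T₀ w) (k / 2) (2 * (k / 2))).image (frameIso i)) := by
    rw [Finset.coe_image]; exact determinedBy_preimage_frameConfig i (determinedBy_triFrameAt _ _)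
  have d2 : DeterminedBy E2 ↑((spokeTube m k T₀ w L ε).sites.image (frameIso i)) := by
    rw [Finset.coe_image, coe_sites]; exact determinedBy_spokeEvent i m k T₀ w L ε
  have d3 : DeterminedBy E3 ↑(sitesAll (arc (thinRing r e s) a len)) := determinedBy_eventAll _
  have d4 : DeterminedBy E4 ↑((triStripFinset ((n : ℤ) - (n / 8 : ℕ) + 1) t W (n / 64)).image (frameIso bs)) := by
    rw [Finset.coe_image]; exact determinedBy_preimage_frameConfig bs (determinedBy_triHCross _ _ _ _)
  have d5 : DeterminedBy E5 ↑((triStripFinset ((n : ℤ) - (n / 8 : ℕ) + 1) (t - (n / 64 : ℕ)) (n / 8 - 2) (2 * (n / 64))).image (frameIso bs)) := by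
    rw [Finset.coe_image]
    exact determinedBy_preimage_frameConfig bs (determinedBy_triVCross _ _ _ _)
  have u1 : IsUpperSet E1 := isUpperSet_bcnEvent i m k T₀ w
  have u2 : IsUpperSet E2 := isUpperSet_spokeEvent i m k T₀ w L ε
  have u3 : IsUpperSet E3 := isUpperSet_eventAll _
  have u4 : IsUpperSet E4 := isUpperSet_preimage_frameConfig bs (isUpperSet_triHCross _ _ _ _)
  have u5 : IsUpperSet E5 := isUpperSet_preimage_frameConfig bs (isUpperSet_triVCross _ _ _ _)
  have p1 : cF ≤ (triSitePercolation q).real E1 := by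
    rw [hE1, bcnEvent, show {χ | frameConfig i χ ∈ triFrameAt (bcnCentre m k T₀ w) (k / 2)} =
      frameConfig i ⁻¹' triFrameAt (bcnCentre m k T₀ w) (k / 2) from rfl, real_preimage_frameConfig]
    exact hF _ _ (by omega) hkcap
  have p2 : c ≤ (triSitePercolation q).real E2 := by
    rw [hE2, spokeEvent, show {χ | frameConfig i χ ∈ (spokeTube m k T₀ w L ε).event} = frameConfig i ⁻¹' (spokeTube m k T₀ w L ε).event
      from rfl, real_preimage_frameConfig]
    refine Tube.le_real_event_at q hrsw hρ1 ?_ ?_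
    · simp only [Tube.AspectLE, spokeTube, cond_true]; exact ⟨by omega, by omega⟩
    · simp only [Tube.short, spokeTube, cond_true]; exact hεcap
  have p3 : c ^ B ≤ (triSitePercolation q).real E3 := by
    refine le_trans (pow_le_pow_of_le_one hc hc1 hlen) ?_
    refine Tube.pow_le_real_eventAll_at q hrsw hρ1 hc _ fun T hT => ⟨?_, ?_⟩
    · exact (aspectLE_of_mem_thinRing he hse (mem_of_mem_arc hT)).mono hρ
    · rw [short_of_mem_thinRing hrs (mem_of_mem_arc hT)]; exact hecap
  have p4 : c ≤ (triSitePercolation q).real E4 := by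
    rw [hE4, show {χ | frameConfig bs χ ∈ tgtH n t W} =
      frameConfig bs ⁻¹' (⟨(n : ℤ) - (n / 8 : ℕ) + 1, t, W, n / 64, true⟩ : Tube).event from rfl, real_preimage_frameConfig]
    refine Tube.le_real_event_at q hrsw hρ1 ?_ ?_
    · simp only [Tube.AspectLE, cond_true]; exact ⟨hW, hn⟩
    · simp only [Tube.short, cond_true]; exact hncap
  have p5 : c ≤ (triSitePercolation q).real E5 := by
    rw [hE5, show {χ | frameConfig bs χ ∈ tgtV n t} =
      frameConfig bs ⁻¹' (⟨(n : ℤ) - (n / 8 : ℕ) + 1, t - (n / 64 : ℕ), n / 8 - 2, 2 * (n / 64), false⟩ : Tube).event from rfl,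
      real_preimage_frameConfig]
    refine Tube.le_real_event_at q hrsw hρ1 ?_ ?_
    · simp only [Tube.AspectLE, cond_false]; exact ⟨hV, hV'⟩
    · simp only [Tube.short, cond_false]; exact hVcap
  have h12 := sitePercolation_harris' q d1 d2 u1 u2
  have d12 : DeterminedBy (E1 ∩ E2) ↑((triSqAnnulusFinset (bcnCentre m k T₀ w) (k / 2) (2 * (k / 2))).image (frameIso i) ∪
      (spokeTube m k T₀ w L ε).sites.image (frameIso i)) := by
    rw [Finset.coe_union]; exact (d1.mono subset_union_left).inter (d2.mono subset_union_right)
  have h123 := sitePercolation_harris' q d12 d3 (u1.inter u2) u3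
  have d123 : DeterminedBy (E1 ∩ E2 ∩ E3) ↑(((triSqAnnulusFinset (bcnCentre m k T₀ w) (k / 2) (2 * (k / 2))).image (frameIso i) ∪
      (spokeTube m k T₀ w L ε).sites.image (frameIso i)) ∪ sitesAll (arc (thinRing r e s) a len)) := by
    rw [Finset.coe_union]; exact (d12.mono subset_union_left).inter (d3.mono subset_union_right)
  have h1234 := sitePercolation_harris' q d123 d4 ((u1.inter u2).inter u3) u4
  have d1234 : DeterminedBy (E1 ∩ E2 ∩ E3 ∩ E4)
      ↑((((triSqAnnulusFinset (bcnCentre m k T₀ w) (k / 2) (2 * (k / 2))).image (frameIso i) ∪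
      (spokeTube m k T₀ w L ε).sites.image (frameIso i)) ∪ sitesAll (arc (thinRing r e s) a len)) ∪
      (triStripFinset ((n : ℤ) - (n / 8 : ℕ) + 1) t W (n / 64)).image (frameIso bs)) := by
    rw [Finset.coe_union]; exact (d123.mono subset_union_left).inter (d4.mono subset_union_right)
  have h12345 := sitePercolation_harris' q d1234 d5 (((u1.inter u2).inter u3).inter u4) u5
  unfold triSitePercolation at p1 p2 p3 p4 p5 ⊢
  unfold icorrEvent4
  rw [← hE1, ← hE2, ← hE3]
  change cF * c ^ (B + 3) ≤ (sitePercolation (Site 2) q).real (E1 ∩ E2 ∩ E3 ∩ E4 ∩ E5)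
  calc cF * c ^ (B + 3) = cF * c * c ^ B * c * c := by ring
    _ ≤ (sitePercolation (Site 2) q).real E1 * (sitePercolation (Site 2) q).real E2 *
        (sitePercolation (Site 2) q).real E3 * (sitePercolation (Site 2) q).real E4 * (sitePercolation (Site 2) q).real E5 := by
      gcongr
    _ ≤ (sitePercolation (Site 2) q).real (E1 ∩ E2 ∩ E3 ∩ E4 ∩ E5) := by
      calc _ ≤ (sitePercolation (Site 2) q).real (E1 ∩ E2) * (sitePercolation (Site 2) q).real E3 *
            (sitePercolation (Site 2) q).real E4 * (sitePercolation (Site 2) q).real E5 := by gcongr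
        _ ≤ (sitePercolation (Site 2) q).real (E1 ∩ E2 ∩ E3) * (sitePercolation (Site 2) q).real E4 *
            (sitePercolation (Site 2) q).real E5 := by gcongr
        _ ≤ (sitePercolation (Site 2) q).real (E1 ∩ E2 ∩ E3 ∩ E4) * (sitePercolation (Site 2) q).real E5 := by gcongr
        _ ≤ _ := h12345

/-! ### The output event -/

/-- **Four arms landed inside on the sides `0, 2, 3, 5` of `∂Λ_n` and outside on the sides at
frame-offset `q`** (`q = 0`: the same sides, Nolin's `Ã̃^{η,I/η',I'}_{4,BWBW}(n, N)` relaxed as in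
`sepFourArmQ`; `q = 3`: the opposite sides): for each landing index `e`, the configuration read in
colour `col e` and frame `ts e` carries a landed arm `sepArmGen n N q`. [cite: Nolin2008, §4.2 Def. 6–8 and §4.4 (arXiv 0711.4948: Def. 6–8, proof of Thm. 10, p. 13)] -/
def sepFourArmG (n N q : ℕ) : Set (SiteConfig (Site 2)) :=
  {ω | ∀ e : Fin 4, frameConfig (Slot4.ts e) (colCfg (Slot4.col e) ω) ∈ sepArmGen n N q}

/-- The untwisted output event is `sepFourArmQ`. [folklore] -/
theorem sepFourArmG_zero (n N : ℕ) : sepFourArmG n N 0 = sepFourArmQ n N := by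
  ext ω
  obtain ⟨c0, c1, c2, c3⟩ := Slot4.col_vals
  have t0 : Slot4.ts 0 = 0 := rfl
  have t1 : Slot4.ts 1 = 2 := rfl
  have t2 : Slot4.ts 2 = 3 := rfl
  have t3 : Slot4.ts 3 = 5 := rfl
  simp only [sepFourArmG, sepFourArmQ, Set.mem_setOf_eq, sepArmGen_zero]
  constructor
  · intro h
    have h0 := h 0; have h1 := h 1; have h2 := h 2; have h3 := h 3
    rw [t0, c0, colCfg_true, frameConfig_zero] at h0
    rw [t1, c1, colCfg_false] at h1
    rw [t2, c2, colCfg_true] at h2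
    rw [t3, c3, colCfg_false] at h3
    exact ⟨h0, h1, h2, h3⟩
  · rintro ⟨h0, h1, h2, h3⟩ e
    fin_cases e
    · show frameConfig (Slot4.ts 0) (colCfg (Slot4.col 0) ω) ∈ _; rw [t0, c0, colCfg_true, frameConfig_zero]; exact h0
    · show frameConfig (Slot4.ts 1) (colCfg (Slot4.col 1) ω) ∈ _; rw [t1, c1, colCfg_false]; exact h1
    · show frameConfig (Slot4.ts 2) (colCfg (Slot4.col 2) ω) ∈ _; rw [t2, c2, colCfg_true]; exact h2
    · show frameConfig (Slot4.ts 3) (colCfg (Slot4.col 3) ω) ∈ _; rw [t3, c3, colCfg_false]; exact h3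

/-! ### Transport of fenced arms along equalities of configurations and regions -/

namespace IntFencedArm

variable {m k₀ K R₀ : ℕ} {A A' : Set (Site 2)} {χ χ' : SiteConfig (Site 2)}

/-- Transport of a fenced arm along equalities of the region and of the configuration. [folklore] -/
def cast (F : IntFencedArm m A k₀ K R₀ χ) (hA : A = A') (hχ : χ = χ') : IntFencedArm m A' k₀ K R₀ χ' where
  z := F.z
  j := F.j
  mm := F.mm
  b := F.b
  z_isIntJ := F.z_isIntJ
  z_mid := F.z_mid
  j_lt := F.j_lt
  b_far := F.b_far
  tipOK := hχ ▸ F.tipOK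
  path := by subst hA hχ; exact F.path
  path_tip := by subst hA hχ; exact F.path_tip

/-- `cast` keeps the data. [folklore] -/
@[simp] theorem cast_data (F : IntFencedArm m A k₀ K R₀ χ) (hA : A = A') (hχ : χ = χ') :
    (F.cast hA hχ).z = F.z ∧ (F.cast hA hχ).j = F.j ∧ (F.cast hA hχ).b = F.b := ⟨rfl, rfl, rfl⟩

end IntFencedArm

/-- The inverse frame shifted by three: `(frameIso ((i+3) % 6))⁻¹ v = (frameIso i)⁻¹ (-v)` (`i < 6`). [folklore] -/
theorem frameIso_add_three_symm {i : ℕ} (hi : i < 6) (v : Site 2) :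
    (frameIso ((i + 3) % 6)).symm v = (frameIso i).symm (-v) := by
  apply (frameIso ((i + 3) % 6)).injective
  rw [RelIso.apply_symm_apply, frameIso_add_three hi, RelIso.apply_symm_apply, neg_neg]

namespace InSlot4

variable {P : LParams} {σ : InSlot4}

/-- `os' e < 6`. [folklore] -/
theorem os'_lt (e : Fin 4) : σ.os' e < 6 := by
  unfold os'; split_ifs
  · exact Nat.mod_lt _ (by norm_num)
  · exact σ.os_lt e

/-- **The region identity of the reading frame**: the region of the arm `e`, read in the frames
`fr' e` and `os' e`, is its region read in the frames `fr e` and `os e`. [folklore] -/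
theorem region_eq {e : Fin 4} (hfr : σ.fr e < 6) (S : Set (Site 2)) :
    (frameIso (σ.fr' e)).symm '' (frameIso (σ.os' e) '' S) = (frameIso (σ.fr e)).symm '' (frameIso (σ.os e) '' S) := by
  have hos := σ.os_lt e
  unfold InSlot4.fr' InSlot4.os'
  by_cases h2 : 2 ≤ (e : ℕ)
  · rw [if_pos h2, if_pos h2]
    ext v
    constructor
    · rintro ⟨_, ⟨x, hx, rfl⟩, rfl⟩
      refine ⟨frameIso (σ.os e) x, ⟨x, hx, rfl⟩, ?_⟩
      rw [show ((frameIso ((σ.os e + 3) % 6) : triGraph ≃g triGraph) x) = frameIso ((σ.os e + 3) % 6) x from rfl,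
        frameIso_add_three hos, show ((frameIso ((σ.fr e + 3) % 6)).symm : triGraph ≃g triGraph) (-frameIso (σ.os e) x) =
        (frameIso ((σ.fr e + 3) % 6)).symm (-frameIso (σ.os e) x) from rfl, frameIso_add_three_symm hfr, neg_neg]
    · rintro ⟨_, ⟨x, hx, rfl⟩, rfl⟩
      refine ⟨frameIso ((σ.os e + 3) % 6) x, ⟨x, hx, rfl⟩, ?_⟩
      rw [show ((frameIso ((σ.os e + 3) % 6) : triGraph ≃g triGraph) x) = frameIso ((σ.os e + 3) % 6) x from rfl,
        frameIso_add_three hos, show ((frameIso ((σ.fr e + 3) % 6)).symm : triGraph ≃g triGraph) (-frameIso (σ.os e) x) =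
        (frameIso ((σ.fr e + 3) % 6)).symm (-frameIso (σ.os e) x) from rfl, frameIso_add_three_symm hfr, neg_neg]
  · rw [if_neg h2, if_neg h2]

/-- The far-end identity of the reading frame. [folklore] -/
theorem farEnd_eq {e : Fin 4} (hfr : σ.fr e < 6) (u : Site 2) :
    (frameIso (σ.fr' e)).symm (frameIso (σ.os' e) u) = (frameIso (σ.fr e)).symm (frameIso (σ.os e) u) := by
  have hos := σ.os_lt e
  unfold InSlot4.fr' InSlot4.os'
  by_cases h2 : 2 ≤ (e : ℕ)
  · rw [if_pos h2, if_pos h2, frameIso_add_three hos, frameIso_add_three_symm hfr, neg_neg]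
  · rw [if_neg h2, if_neg h2]

/-- The reading configuration framed by `os' e` is the colour-read configuration framed by `os e`. [folklore] -/
theorem frameConfig_os' (e : Fin 4) (ω : SiteConfig (Site 2)) :
    frameConfig (σ.os' e) (Slot4.psiCfg e ω) = frameConfig (σ.os e) (colCfg (Slot4.col e) ω) := by
  unfold Slot4.psiCfg InSlot4.os'
  by_cases h2 : 2 ≤ (e : ℕ)
  · rw [if_pos h2, if_pos h2]; exact frameConfig_add_three_three (σ.os_lt e) _
  · rw [if_neg h2, if_neg h2]

/-- The reading configuration framed by `fr' e` is the colour-read configuration framed by `fr e` (`fr e < 6`). [folklore] -/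
theorem frameConfig_fr' {e : Fin 4} (hfr : σ.fr e < 6) (ω : SiteConfig (Site 2)) :
    frameConfig (σ.fr' e) (Slot4.psiCfg e ω) = frameConfig (σ.fr e) (colCfg (Slot4.col e) ω) := by
  unfold Slot4.psiCfg InSlot4.fr'
  by_cases h2 : 2 ≤ (e : ℕ)
  · rw [if_pos h2, if_pos h2]; exact frameConfig_add_three_three hfr _
  · rw [if_neg h2, if_neg h2]

/-- The twist offset of the slot: `0` or `3`. [folklore] -/
def twq (σ : InSlot4) : ℕ := if σ.tw then 3 else 0

/-- **The frame bookkeeping of the output, (i)**: reading the base side of the reading configuration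
is reading the landing side of the colour-read configuration. [folklore] -/
theorem output_cfg (e : Fin 4) (ω : SiteConfig (Site 2)) :
    frameConfig (Slot4.bs e) (Slot4.psiCfg e ω) = frameConfig (Slot4.ts e) (colCfg (Slot4.col e) ω) := by
  fin_cases e
  · rfl
  · rfl
  · show frameConfig 0 (frameConfig 3 (colCfg (Slot4.col 2) ω)) = frameConfig 3 (colCfg (Slot4.col 2) ω)
    exact frameConfig_zero _
  · show frameConfig 2 (frameConfig 3 (colCfg (Slot4.col 3) ω)) = frameConfig 5 (colCfg (Slot4.col 3) ω)
    exact frameConfig_two_three _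

/-- **The frame bookkeeping of the output, (ii)**: for the base side `0`, the relative outer side is the twist offset. [folklore] -/
theorem os'_eq_twq {e : Fin 4} (he : Slot4.bs e = 0) : σ.os' e = σ.twq := by
  fin_cases e
  · show σ.os 0 = σ.twq
    unfold InSlot4.os InSlot4.twq
    cases σ.tw <;> rfl
  · exact absurd he (by decide)
  · show (σ.os 2 + 3) % 6 = σ.twq
    unfold InSlot4.os InSlot4.twq
    cases σ.tw <;> rfl
  · exact absurd he (by decide)

/-- **The frame bookkeeping of the output, (iii)**: for the base side `2`, `frameIso twq = σ ∘ frameIso (os' e)`. [folklore] -/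
theorem frameIso_twq {e : Fin 4} (he : Slot4.bs e = 2) (v : Site 2) : frameIso σ.twq v = frameIso 2 (frameIso (σ.os' e) v) := by
  obtain ⟨-, t1, -, t3⟩ := frameIso_swap_comp v
  fin_cases e
  · exact absurd he (by decide)
  · show frameIso σ.twq v = frameIso 2 (frameIso (σ.os 1) v)
    unfold InSlot4.os InSlot4.twq
    cases σ.tw
    · exact t1
    · exact t3
  · exact absurd he (by decide)
  · show frameIso σ.twq v = frameIso 2 (frameIso ((σ.os 3 + 3) % 6) v)
    unfold InSlot4.os InSlot4.twq
    cases σ.tw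
    · exact t1
    · exact t3

/-! ### The move -/

/-- pure arithmetic: a reading position of the exit run is a lane position [folklore] -/
private theorem run_lt_G {g x d n : ℕ} (hg : g ≤ 2 * x + 2 * d) (hxd : x + d < n) : g < 12 * n - 4 := by omega

/-- pure arithmetic: the reading positions on the side `2` [folklore] -/
private theorem piecePos_two {n j : ℕ} (hj : j < n) : piecePos n 2 j = 6 * n - 3 - 2 * j := by
  unfold piecePos blockOff; simp only [show (2 : ℕ) % 3 = 2 from rfl, if_true]; omega

/-- pure arithmetic: the reading positions on the side `0` [folklore] -/
private theorem piecePos_zero' (n j : ℕ) : piecePos n 0 j = 2 * j := by unfold piecePos blockOff; simp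

set_option maxHeartbeats 400000 in
/-- **The move of one arm.** For a valid rung (`K ≥ 1`, `R₀ ≥ 16 μ`), a slot in range with the routing
predicate, on the arm event and the corridor event of the arm `e`:
`frameConfig (ts e) (colCfg (col e) ω) ∈ sepArmGen n N twq`. [cite: Nolin2008, §4.3 Prop. 12 and §4.4 (arXiv 0711.4948: Prop. 11, Thm. 10, p. 13)] -/
theorem move_one (hV : P.Valid) (hK : 1 ≤ P.K) (hR16 : 16 * P.μ ≤ P.R₀) (hσ : σ.InRange P) (hR : RouteOK P σ) (e : Fin 4)
    {ω : SiteConfig (Site 2)} (hA : ω ∈ σ.armE P e) (hC : ω ∈ σ.corrE P e) :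
    frameConfig (Slot4.ts e) (colCfg (Slot4.col e) ω) ∈ sepArmGen P.n P.N σ.twq := by
  -- (0) numeric facts, in small contexts (`omega` only before the arm facts enter)
  obtain ⟨hs, hw, he, hε, hk₀, -, -, -, -, -, -, -, hm, hN, hn, hμn, hR₀, -⟩ := hV.facts
  have hs1 : 1 ≤ P.s := by rw [hs]; exact le_trans (by norm_num) hk₀
  have hsk : (P.s : ℤ) = P.k₀ := by rw [hs]
  have hk₀z : 64 ≤ (P.k₀ : ℤ) := by exact_mod_cast hk₀
  have hmz : (P.m : ℤ) = 2 * P.n + 1 := by exact_mod_cast hm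
  have hnz : 128 ≤ (P.n : ℤ) := by exact_mod_cast hn
  have hμnz : 64 * (P.μ : ℤ) ≤ P.n := by exact_mod_cast hμn
  have hR₀z : 8 * (P.μ : ℤ) ≤ P.R₀ := by exact_mod_cast hR₀
  have hR16z : 16 * (P.μ : ℤ) ≤ P.R₀ := by exact_mod_cast hR16
  have hw4 : 4 * (P.w : ℤ) ≤ P.k₀ ∧ (P.k₀ : ℤ) ≤ 4 * P.w + 3 := by rw [hw]; constructor <;> omega
  have he4 : 4 * (P.e : ℤ) ≤ P.k₀ ∧ (P.k₀ : ℤ) ≤ 4 * P.e + 3 := by rw [he]; constructor <;> omega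
  have hε16 : 16 * (P.ε : ℤ) ≤ P.k₀ ∧ (P.k₀ : ℤ) ≤ 16 * P.ε + 15 := by rw [hε]; constructor <;> omega
  have hn4 : 4 * ((P.n / 4 : ℕ) : ℤ) ≤ P.n ∧ (P.n : ℤ) < 4 * ((P.n / 4 : ℕ) : ℤ) + 4 := by constructor <;> omega
  have hn16 : (0 : ℤ) ≤ ((P.n / 16 : ℕ) : ℤ) := by positivity
  have hn64d : 64 * ((P.n / 64 : ℕ) : ℤ) ≤ P.n := by omega
  have hq0 : (0 : ℤ) ≤ ((σ.k P e / 4 : ℕ) : ℤ) := by positivity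
  have hε0 : (0 : ℤ) ≤ P.ε := by positivity
  have he0 : (0 : ℤ) ≤ P.e := by positivity
  have hkz0 : (0 : ℤ) ≤ σ.k P e := by positivity
  obtain ⟨ke1, ke2, re1, re2, nse', rW, re5, re6, Le, ne1, nse, Ge, dve, ⟨te1, te2⟩, hμe, hμe'⟩ := arm_facts hV hK hσ e
  obtain ⟨ha1, ha2⟩ := adm_of_mem hA
  have hεez : (P.ε : ℤ) ≤ P.e := by linarith only [hε16.1, he4.2, hk₀z, hε0]
  have hεe : P.ε ≤ P.e := by exact_mod_cast hεez
  have hJa : (P.m : ℤ) - 2 * σ.k P e + 1 + P.s + P.e + P.ε ≤ σ.r P e + σ.L P e := by linarith only [re2, Le, hkz0, hεez, he0]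
  have hJb : (σ.r P e : ℤ) + P.e + P.ε ≤ (P.m : ℤ) - 2 * σ.k P e + 1 + (σ.k P e / 4 : ℕ) := by
    linarith only [re1, hμe, ke2, ke1, he4.1, hεez, hq0]
  have hwk : 4 * P.w ≤ σ.k P e := by exact_mod_cast (show 4 * (P.w : ℤ) ≤ σ.k P e by linarith only [hw4.1, ke1])
  have hk4 : 4 ≤ σ.k P e := by exact_mod_cast (show (4 : ℤ) ≤ σ.k P e by linarith only [ke1, hk₀z])
  have hε4 : 4 * P.ε ≤ σ.k P e := by exact_mod_cast (show 4 * (P.ε : ℤ) ≤ σ.k P e by linarith only [hε16.1, ke1, hε0])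
  have hL2 : 2 * σ.k P e ≤ σ.L P e := by
    exact_mod_cast (show 2 * (σ.k P e : ℤ) ≤ σ.L P e by linarith only [Le, hμe, ke2, hkz0, he0, hsk, hk₀z])
  have hsr' : P.s ≤ σ.r P e := by exact_mod_cast (show (P.s : ℤ) ≤ σ.r P e by linarith only [re5, hnz, he0])
  have he2r : 2 * P.e ≤ σ.r P e := by exact_mod_cast (show 2 * (P.e : ℤ) ≤ σ.r P e by linarith only [re5, hnz, hsk, hk₀z])
  have hn64 : 64 ≤ P.n := le_trans (by norm_num) hn
  have hnL : (P.n : ℤ) + 2 * σ.k P e + σ.L P e ≤ P.m + 1 := by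
    linarith only [Le, hμe', hmz, hμnz, ke2, ke1, hsk, he4.1, hk₀z]
  have hn5 : (P.n : ℤ) + 5 * σ.k P e ≤ P.m := by linarith only [hmz, ke2, hμnz, hkz0]
  have hR4 : 4 * σ.k P e ≤ P.R₀ := by exact_mod_cast (show 4 * (σ.k P e : ℤ) ≤ P.R₀ by linarith only [ke2, hR₀z, hkz0])
  have hes : (P.e : ℤ) ≤ P.s := by linarith only [he4.1, hsk, he0]
  have hfr := hσ.hfr e
  have hfr' := fr'_lt hσ e
  have hos' := os'_lt (σ := σ) e
  -- the entry piece
  have hξlo : -(σ.r P e : ℤ) + 2 * P.s ≤ σ.ξ P e := by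
    unfold InSlot4.ξ; linarith only [ha2, re2, hμe', hR16z, ke2, ke1, hsk, hkz0]
  have hξhi : σ.ξ P e + 2 * P.s < 0 := by
    unfold InSlot4.ξ; linarith only [ha1, hR₀z, ke2, ke1, hsk, hw4.1, hk₀z]
  have hξr : -(σ.r P e : ℤ) ≤ σ.ξ P e := by linarith only [hξlo, hsk, hk₀z]
  obtain ⟨ι, hι⟩ : ∃ ι : ℕ, ι = latIdx P.s (σ.r P e) (σ.ξ P e) := ⟨_, rfl⟩
  have hιn : ι + 2 < σ.nr P e := by
    rw [hι]; exact latIdx_add_lt (m := 2) hs1 nse' hξr (by push_cast; linarith only [hξhi])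
  have hspec := latIdx_spec (s := P.s) (r := σ.r P e) hs1 hξr
  rw [← hι] at hspec
  have hnsn : σ.nr P e * P.s = σ.r P e := by exact_mod_cast nse'
  have hιlt : ι < σ.nr P e := lt_of_le_of_lt (Nat.le_add_right ι 2) hιn
  have hspec' : -(σ.r P e : ℤ) + ι * P.s ≤ σ.T P e + 2 * σ.k P e + P.w ∧ σ.T P e + 2 * σ.k P e + P.w < -(σ.r P e : ℤ) + (ι + 1) * P.s := by
    unfold InSlot4.ξ at hspec; exact hspec
  have hJ : SpokeMeets (σ.fr' e) (spokeTube P.m (σ.k P e) (σ.T P e) P.w (σ.L P e) P.ε) (pieceTube (σ.r P e) P.e P.s (σ.nr P e) (σ.fr' e) ι) :=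
    spokeMeets_pieceTube hfr' hnsn hιlt hspec' hεe hJa hJb
  have hGe : σ.G P e = 12 * (σ.r P e / P.s) - 4 := by rw [Ge, nse]
  obtain ⟨hast, haln1, haln⟩ := hR.1 e
  have hTe : pieceTube (σ.r P e) P.e P.s (σ.nr P e) (σ.fr' e) ι ∈ arc (thinRing (σ.r P e) P.e P.s) (σ.ast e) (σ.aln e) := by
    have hin := hR.2.2.1 e
    unfold InSlot4.pE at hin
    rw [← hι, hGe] at hin
    rw [nse, ← ringTube_piecePos (nse ▸ ne1) hfr' (by rw [← nse]; exact hιlt)]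
    exact ringTube_mem_arc_of_inArc (nse ▸ ne1) (by rw [← hGe]; exact hast) (by rw [← nse]; exact piecePos_lt ne1 hfr' hιlt) hin
  -- the exit run
  have htr : -(σ.r P e : ℤ) ≤ σ.t P e := by linarith only [te1, re5, hn4.1, hn16, hsk, hk₀z, he0]
  have hx := latIdx_spec (s := P.s) (r := σ.r P e) hs1 htr
  obtain ⟨hd1, hd2⟩ := P.d_mul_facts hs1
  have hd1' : ((P.d + 1 : ℕ) : ℤ) * P.s ≤ (P.n / 64 : ℕ) + 4 * P.s := by exact_mod_cast hd1
  have hd2' : ((P.n / 64 : ℕ) : ℤ) + 2 * P.s ≤ (P.d : ℤ) * P.s := by exact_mod_cast hd2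
  have hxd : σ.x P e + P.d < σ.nr P e := by
    have h := latIdx_add_lt (s := P.s) (r := σ.r P e) (n := σ.nr P e) (m := P.d + 1) hs1 nse' htr
      (by linarith only [te2, hd1', hn4.2, hn16, hn64d, hsk, ke1, ke2, hμnz, hnz])
    unfold InSlot4.x; exact Nat.lt_of_succ_lt h
  have hxdn : σ.x P e + P.d < σ.r P e / P.s := by rw [← nse]; exact hxd
  have hxn : σ.x P e < σ.r P e / P.s := lt_of_le_of_lt (Nat.le_add_right _ _) hxdn
  have hrun_in : ∀ g, σ.runLo P e ≤ g → g ≤ σ.runHi P e → g < σ.G P e →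
      ringTube (σ.r P e) P.e P.s g ∈ arc (thinRing (σ.r P e) P.e P.s) (σ.ast e) (σ.aln e) := fun g h1 h2 h3 => by
    have hin := hR.2.2.2.1 e g h3 h1 h2
    rw [hGe] at hin h3
    exact ringTube_mem_arc_of_inArc (nse ▸ ne1) (by rw [← hGe]; exact hast) h3 hin
  have hlo : -(σ.r P e : ℤ) + σ.x P e * P.s - P.e ≤ σ.t P e := by unfold InSlot4.x; linarith only [hx.1, he0]
  have hhi : σ.t P e + (P.n / 64 : ℕ) ≤ -(σ.r P e : ℤ) + (σ.x P e + P.d) * P.s - P.e := by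
    have hxds : ((σ.x P e : ℕ) + (P.d : ℕ) : ℤ) * P.s = (σ.x P e : ℤ) * P.s + (P.d : ℤ) * P.s := by ring
    rw [hxds]
    unfold InSlot4.x at hxds ⊢
    linarith only [hx.2, hd2', hes]
  -- the exit runs on the two base sides
  have hSL0 : Slot4.bs e = 0 → ∀ T ∈ vchunks (σ.r P e) (-(σ.r P e : ℤ)) P.e P.s (σ.x P e) (P.d + 1),
      T ∈ arc (thinRing (σ.r P e) P.e P.s) (σ.ast e) (σ.aln e) := by
    intro hb0 T hT
    obtain ⟨g, hg1, hg2, rfl⟩ := exists_pos_of_mem_vchunks hxdn hT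
    have hrl : σ.runLo P e = 2 * σ.x P e ∧ σ.runHi P e = 2 * (σ.x P e + P.d) := by
      unfold InSlot4.runLo InSlot4.runHi
      rw [hb0, piecePos_zero', piecePos_zero']
      exact ⟨min_eq_left (Nat.mul_le_mul_left 2 (Nat.le_add_right _ _)), max_eq_right (Nat.mul_le_mul_left 2 (Nat.le_add_right _ _))⟩
    refine hrun_in g (hrl.1 ▸ hg1) (by rw [hrl.2, Nat.mul_add]; exact hg2) ?_
    rw [Ge]; exact run_lt_G hg2 hxd
  have hSL2 : Slot4.bs e = 2 → ∀ T ∈ vchunks (σ.r P e) (-(σ.r P e : ℤ)) P.e P.s (σ.x P e) (P.d + 1),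
      T.swap ∈ arc (thinRing (σ.r P e) P.e P.s) (σ.ast e) (σ.aln e) := by
    intro hb2 T hT
    obtain ⟨g, hg1, hg2, hg3, hgT⟩ := exists_pos_swap_of_mem_vchunks (nse ▸ ne1) (by rw [← nse]; exact hnsn) hxdn hT
    rw [← hgT]
    have hle : piecePos (σ.r P e / P.s) 2 (σ.x P e + P.d) ≤ piecePos (σ.r P e / P.s) 2 (σ.x P e) := by
      rw [piecePos_two hxdn, piecePos_two hxn]
      exact Nat.sub_le_sub_left (Nat.mul_le_mul_left 2 (Nat.le_add_right _ _)) _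
    have hrl : σ.runLo P e = piecePos (σ.r P e / P.s) 2 (σ.x P e + P.d) ∧ σ.runHi P e = piecePos (σ.r P e / P.s) 2 (σ.x P e) := by
      unfold InSlot4.runLo InSlot4.runHi; rw [hb2, nse]
      exact ⟨min_eq_right hle, max_eq_left hle⟩
    exact hrun_in g (hrl.1 ▸ hg1) (hrl.2 ▸ hg2) (by rw [hGe]; exact hg3)
  -- (1) the arm, in the reading configuration
  obtain ⟨z, u, hz, hOut, F, hj, hw1', hw2', hb⟩ := hA
  have hk : F.k = σ.k P e := by show trapScale P.k₀ F.j = trapScale P.k₀ (σ.sc e); rw [hj]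
  have hA : (frameIso (σ.fr e)).symm '' (frameIso (σ.os e) '' armRegion P.m P.N z) =
      (frameIso (σ.fr' e)).symm '' (frameIso (σ.os' e) '' armRegion P.m P.N z) := (region_eq hfr _).symm
  have hχ : frameConfig (σ.fr e) (colCfg (Slot4.col e) ω) = frameConfig (σ.fr' e) (Slot4.psiCfg e ω) := (frameConfig_fr' hfr ω).symm
  have hk' : (F.cast hA hχ).k = σ.k P e := hk
  have hz' : (F.cast hA hχ).z = F.z := rfl
  have hb' : (F.cast hA hχ).b = (frameIso (σ.fr' e)).symm (frameIso (σ.os' e) u) := by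
    rw [show (F.cast hA hχ).b = F.b from rfl, hb, farEnd_eq hfr]
  have hOut' : OpenVCrossThrough (sepOuterFence P.N z) (z 1 - (P.N / 64 : ℕ)) (z 1 + (P.N / 64 : ℕ))
      (frameConfig (σ.os' e) (Slot4.psiCfg e ω)) u := by
    rw [frameConfig_os']; exact hOut
  -- (2) the corridor
  obtain ⟨⟨⟨⟨hB, hSp⟩, harc⟩, hH⟩, hVt⟩ := hC
  rw [← output_cfg e ω]
  -- (3) the sides
  have hbs : Slot4.bs e = 0 ∨ Slot4.bs e = 2 := by unfold Slot4.bs; split_ifs <;> simp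
  rcases hbs with hb0 | hb2
  · -- right side
    rw [hb0, frameConfig_zero, ← os'_eq_twq hb0]
    rw [hb0] at hH hVt
    simp only [Set.mem_setOf_eq, frameConfig_zero] at hH hVt
    exact landing_move_gen hos' hfr' hz hOut' (F.cast hA hχ) hb' (T₀ := σ.T P e) (w := P.w)
      (by rw [hk']; exact hwk) (by rw [hk']; exact hk4) (by rw [hz']; exact ⟨hw1', hw2'⟩) (by rw [hk']; exact hB) (L := σ.L P e) (ε := P.ε)
      (by rw [hk']; exact hε4) (by rw [hk']; exact hL2) (by rw [hk']; exact hSp) hs1 dve hsr' he2r harc hTe (by rw [hk']; exact hJ)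
      ⟨te1, te2⟩ (hSL0 hb0) hlo hhi rW hH hVt hn64 re5 re6 hN (by rw [hk']; exact hnL) (by rw [hk']; exact hn5) (by rw [hk']; exact hR4)
  · -- top side
    rw [hb2]
    rw [hb2] at hH hVt
    simp only [Set.mem_setOf_eq] at hH hVt
    exact landing_move_gen_two hos' (frameIso_twq hb2) hfr' hz hOut' (F.cast hA hχ) hb' (T₀ := σ.T P e) (w := P.w)
      (by rw [hk']; exact hwk) (by rw [hk']; exact hk4) (by rw [hz']; exact ⟨hw1', hw2'⟩) (by rw [hk']; exact hB) (L := σ.L P e) (ε := P.ε)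
      (by rw [hk']; exact hε4) (by rw [hk']; exact hL2) (by rw [hk']; exact hSp) hs1 dve hsr' he2r harc hTe (by rw [hk']; exact hJ)
      ⟨te1, te2⟩ (hSL2 hb2) hlo hhi rW hH hVt hn64 re5 re6 hN (by rw [hk']; exact hnL) (by rw [hk']; exact hn5) (by rw [hk']; exact hR4)

/-- **The move.** On the four arm events and the four corridor events of a routed slot in range, the
configuration has four alternating arms landed inside on the sides `0, 2, 3, 5` of `∂Λ_n` and outside on
the sides at offset `twq`: `(⋂ₑ armE e) ∩ (⋂ₑ corrE e) ⊆ sepFourArmG n N twq`. [cite: Nolin2008, §4.3 Prop. 12 and §4.4 (arXiv 0711.4948: Prop. 11, Thm. 10, p. 13)] -/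
theorem move (hV : P.Valid) (hK : 1 ≤ P.K) (hR16 : 16 * P.μ ≤ P.R₀) (hσ : σ.InRange P) (hR : RouteOK P σ) {ω : SiteConfig (Site 2)}
    (hA : ∀ e, ω ∈ σ.armE P e) (hC : ∀ e, ω ∈ σ.corrE P e) : ω ∈ sepFourArmG P.n P.N σ.twq :=
  fun e => move_one hV hK hR16 hσ hR e (hA e) (hC e)

/-! ### Nolin's Lemma 13 per slot, and the sum over slots -/

/-- The intersection of the four arm events, grouped by colour. [folklore] -/
theorem iInter_armE_eq (P : LParams) (σ : InSlot4) :
    (⋂ e, σ.armE P e) = (σ.armE P 0 ∩ σ.armE P 2) ∩ (σ.armE P 1 ∩ σ.armE P 3) := by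
  ext ω
  simp only [Set.mem_iInter, Set.mem_inter_iff]
  constructor
  · intro h; exact ⟨⟨h 0, h 2⟩, h 1, h 3⟩
  · rintro ⟨⟨h0, h2⟩, h1, h3⟩ e
    fin_cases e <;> assumption

/-- **The corridor of the arm `e` has probability at least `c_F c^(B+3)` at density `p`** (through the
reading map: at `p` for the open arms, at `1 - p` for the closed ones). [cite: Nolin2008, §4.3 Prop. 12 (proof) (arXiv 0711.4948: Prop. 11)] -/
theorem real_corrE_ge (hV : P.Valid) (hK : 1 ≤ P.K) (hσ : σ.InRange P) (hR : RouteOK P σ) (p : unitInterval) {cF c : ℝ} {ρ Ncap B : ℕ}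
    (hF : ∀ q : unitInterval, (q = p ∨ q = unitInterval.symm p) →
      ∀ (z : Site 2) (k : ℕ), 1 ≤ k → k ≤ Ncap → cF ≤ (triSitePercolation q).real (triFrameAt z k))
    (hrsw : ∀ q : unitInterval, (q = p ∨ q = unitInterval.symm p) →
      ∀ n : ℕ, 1 ≤ ⌊(ρ : ℝ) * n⌋₊ → n ≤ Ncap → c ≤ triLRCrossingProb q ⌊(ρ : ℝ) * n⌋₊ n)
    (hρ : 128 ≤ ρ) (hc : 0 ≤ c) (hsp : P.iLL 7 + P.μ ≤ ρ * (2 * P.ε)) (hcap : P.n / 8 ≤ Ncap) (hB : P.iGr 0 ≤ B) (e : Fin 4) :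
    cF * c ^ (B + 3) ≤ (triSitePercolation p).real (σ.corrE P e) := by
  obtain ⟨hs, hw, he, hε, hk₀, -, -, -, -, -, -, -, hm, hN, hn, hμn, hR₀, hR₀n⟩ := hV.facts
  obtain ⟨ke1, ke2, re1, re2, nse', rW, re5, re6, Le, ne1, nse, Ge, dve, ⟨te1, te2⟩, hμe, hμe'⟩ := arm_facts hV hK hσ e
  obtain ⟨hast, haln1, haln⟩ := hR.1 e
  have hsk : (P.s : ℤ) = P.k₀ := by rw [hs]
  have hw4 : 4 * (P.w : ℤ) ≤ P.k₀ := by rw [hw]; omega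
  have hε16 : 16 * (P.ε : ℤ) ≤ P.k₀ := by rw [hε]; omega
  have hε16' : (P.k₀ : ℤ) ≤ 16 * P.ε + 15 := by rw [hε]; omega
  have he4 : 4 * (P.e : ℤ) ≤ P.k₀ := by rw [he]; omega
  have he4' : (P.k₀ : ℤ) ≤ 4 * P.e + 3 := by rw [he]; omega
  have hLL7 : (P.iLL 7 : ℤ) = 15 * P.μ + 2 * P.s + 4 * P.e := by unfold LParams.iLL; push_cast; ring
  have hsp' : (P.iLL 7 : ℤ) + P.μ ≤ ρ * (2 * P.ε) := by exact_mod_cast hsp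
  unfold corrE
  rw [show {ω | Slot4.psiCfg e ω ∈ icorrEvent4 (σ.fr' e) P.m P.n (σ.k P e) (σ.T P e) P.w (σ.L P e) P.ε (σ.r P e) P.e P.s (σ.ast e)
      (σ.aln e) (Slot4.bs e) (σ.t P e) (σ.W P e)} = {ω | Slot4.psiCfg e ω ∈ icorrEvent4 (σ.fr' e) P.m P.n (σ.k P e) (σ.T P e) P.w
      (σ.L P e) P.ε (σ.r P e) P.e P.s (σ.ast e) (σ.aln e) (Slot4.bs e) (σ.t P e) (σ.W P e)} from rfl, real_preimage_psiCfg]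
  set q : unitInterval := if Slot4.col e then p else unitInterval.symm p with hq
  have hq' : q = p ∨ q = unitInterval.symm p := by rw [hq]; split_ifs <;> simp
  have hlen : (arc (thinRing (σ.r P e) P.e P.s) (σ.ast e) (σ.aln e)).length ≤ B := by
    rw [length_arc (by rw [length_thinRing (nse ▸ ne1), ← nse, ← Ge]; exact haln)]
    have h0 := hV.inL_le_inL_zero (hσ.hlv e)
    have : σ.G P e ≤ P.iGr 0 := by rw [Ge]; unfold LParams.iGr InSlot4.nr at *; omega
    omega
  refine real_icorrEvent4_ge_at q (hF q hq') (hrsw q hq') (by omega) hc (k := σ.k P e) (by omega) ?_ ?_ ?_ ?_ ?_ ?_ ?_ (nse ▸ ne1)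
    ?_ ?_ ?_ ?_ ?_ ?_ hlen
  · have : (σ.k P e : ℤ) / 2 ≤ (P.n / 8 : ℕ) := by omega
    omega
  · omega
  · omega
  · zify; rw [Le]; omega
  · omega
  · omega
  · omega
  · omega
  · omega
  · have hW : (σ.W P e : ℤ) ≤ P.m := by omega
    have h64 : (P.n : ℤ) ≤ 64 * ((P.n / 64 : ℕ) : ℤ) + 63 := by omega
    have h1 : σ.W P e ≤ 128 * (P.n / 64) := by zify; omega
    exact h1.trans (Nat.mul_le_mul_right _ hρ)
  · have hρ' : 1 ≤ ρ := by omega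
    calc 2 * (P.n / 64) ≤ 1 * (P.n / 8 - 2) := by omega
      _ ≤ ρ * (P.n / 8 - 2) := Nat.mul_le_mul_right _ hρ'
  · omega
  · omega

/-- **Nolin's Lemma 13 for a routed inner slot** at density `p`:
`P_p(⋂ₑ armE e) · (c_F c^(B+3))⁴ ≤ P_p(sepFourArmG n N twq)` (generalised FKG with the shared support
`sharedFin m (N + N/8)`, the private supports of the two open arms and of the two closed arms, pairwise
disjoint for a routed slot holding the four arms; valid rung with `K ≥ 1`, `R₀ ≥ 16 μ`). [cite: Nolin2008, §4.3 Prop. 12 and Lemma 13 (arXiv 0711.4948: Prop. 11, Lemma 12); §4.4 p. 13] -/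
theorem real_arms_le (hV : P.Valid) (hK : 1 ≤ P.K) (hR16 : 16 * P.μ ≤ P.R₀) (hσ : σ.InRange P) (hR : RouteOK P σ) (p : unitInterval)
    {cF c : ℝ} {ρ Ncap B : ℕ}
    (hF : ∀ q : unitInterval, (q = p ∨ q = unitInterval.symm p) →
      ∀ (z : Site 2) (k : ℕ), 1 ≤ k → k ≤ Ncap → cF ≤ (triSitePercolation q).real (triFrameAt z k))
    (hrsw : ∀ q : unitInterval, (q = p ∨ q = unitInterval.symm p) →
      ∀ n : ℕ, 1 ≤ ⌊(ρ : ℝ) * n⌋₊ → n ≤ Ncap → c ≤ triLRCrossingProb q ⌊(ρ : ℝ) * n⌋₊ n)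
    (hρ : 128 ≤ ρ) (hc : 0 ≤ c) (hcF : 0 ≤ cF) (hsp : P.iLL 7 + P.μ ≤ ρ * (2 * P.ε)) (hcap : P.n / 8 ≤ Ncap) (hB : P.iGr 0 ≤ B) :
    (triSitePercolation p).real (⋂ e, σ.armE P e) * (cF * c ^ (B + 3)) ^ 4 ≤ (triSitePercolation p).real (sepFourArmG P.n P.N σ.twq) := by
  classical
  by_cases hne : (⋂ e, σ.armE P e).Nonempty
  swap
  · rw [Set.not_nonempty_iff_eq_empty.1 hne, measureReal_empty, zero_mul]; exact measureReal_nonneg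
  obtain ⟨ω₀, hω₀⟩ := hne
  rw [Set.mem_iInter] at hω₀
  have hadm : σ.Adm P := fun e => adm_of_mem (hω₀ e)
  have hk2 : 2 ≤ P.k₀ := le_trans (by norm_num) hV.hk₀
  have hk1 : 1 ≤ P.k₀ := le_trans (by norm_num) hV.hk₀
  have hN2 : 2 * P.m ≤ P.N := hV.hN
  obtain ⟨c0, c1, c2, c3⟩ := Slot4.col_vals
  set Sh := sharedFin P.m (P.N + P.N / 8) with hSh
  -- the three pairwise disjoint regions of Nolin's Lemma 13
  have dS : ∀ e, Disjoint Sh (σ.privE P e) := fun e => disjoint_sharedFin_privE hV hK hσ hadm hR _ e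
  have hSP : Disjoint Sh (σ.privE P 0 ∪ σ.privE P 2) := Finset.disjoint_union_right.2 ⟨dS 0, dS 2⟩
  have hSM : Disjoint Sh (σ.privE P 1 ∪ σ.privE P 3) := Finset.disjoint_union_right.2 ⟨dS 1, dS 3⟩
  have hPM : Disjoint (σ.privE P 0 ∪ σ.privE P 2) (σ.privE P 1 ∪ σ.privE P 3) := by
    rw [Finset.disjoint_union_left, Finset.disjoint_union_right, Finset.disjoint_union_right]
    exact ⟨⟨disjoint_privE hV hK hR16 hσ hadm hR (by rw [c0, c1]; decide), disjoint_privE hV hK hR16 hσ hadm hR (by rw [c0, c3]; decide)⟩,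
      disjoint_privE hV hK hR16 hσ hadm hR (by rw [c2, c1]; decide), disjoint_privE hV hK hR16 hσ hadm hR (by rw [c2, c3]; decide)⟩
  -- supports of the arm events
  have dA : ∀ e, DeterminedBy (σ.armE P e) ((↑Sh : Set (Site 2)) ∪ ↑(σ.privE P e)) := fun e =>
    (determinedBy_armE hN2 le_rfl hk1 (hσ.hfr e) (σ.os_lt e)).mono (Set.union_subset_union_right _ (image_slotFrame_subset_privE (hσ.hfr e)))
  have dAp : DeterminedBy (σ.armE P 0 ∩ σ.armE P 2) (↑Sh ∪ ↑(σ.privE P 0 ∪ σ.privE P 2)) := by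
    rw [Finset.coe_union]
    exact ((dA 0).mono fun v hv => hv.elim (fun h => Or.inl h) fun h => Or.inr (Or.inl h)).inter
      ((dA 2).mono fun v hv => hv.elim (fun h => Or.inl h) fun h => Or.inr (Or.inr h))
  have dAm : DeterminedBy (σ.armE P 1 ∩ σ.armE P 3) (↑Sh ∪ ↑(σ.privE P 1 ∪ σ.privE P 3)) := by
    rw [Finset.coe_union]
    exact ((dA 1).mono fun v hv => hv.elim (fun h => Or.inl h) fun h => Or.inr (Or.inl h)).inter
      ((dA 3).mono fun v hv => hv.elim (fun h => Or.inl h) fun h => Or.inr (Or.inr h))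
  have dC : ∀ e, DeterminedBy (σ.corrE P e) ↑(σ.privE P e) := fun e => determinedBy_corrE hk2 e
  have dBp : DeterminedBy (σ.corrE P 0 ∩ σ.corrE P 2) ↑(σ.privE P 0 ∪ σ.privE P 2) := by
    rw [Finset.coe_union]; exact ((dC 0).mono subset_union_left).inter ((dC 2).mono subset_union_right)
  have dBm : DeterminedBy (σ.corrE P 1 ∩ σ.corrE P 3) ↑(σ.privE P 1 ∪ σ.privE P 3) := by
    rw [Finset.coe_union]; exact ((dC 1).mono subset_union_left).inter ((dC 3).mono subset_union_right)
  -- monotonicity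
  have uAp : IsUpperSet (σ.armE P 0 ∩ σ.armE P 2) := (isUpperSet_armE P σ c0).inter (isUpperSet_armE P σ c2)
  have lAm : IsLowerSet (σ.armE P 1 ∩ σ.armE P 3) := (isLowerSet_armE P σ c1).inter (isLowerSet_armE P σ c3)
  have uBp : IsUpperSet (σ.corrE P 0 ∩ σ.corrE P 2) := (isUpperSet_corrE P σ c0).inter (isUpperSet_corrE P σ c2)
  have lBm : IsLowerSet (σ.corrE P 1 ∩ σ.corrE P 3) := (isLowerSet_corrE P σ c1).inter (isLowerSet_corrE P σ c3)
  have fkg := triSitePercolation_locallyMonotone_fkg p hSP hSM hPM uAp lAm uBp lBm dAp dAm dBp dBm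
  -- the corridor probabilities
  have hC := real_corrE_ge hV hK hσ hR p hF hrsw hρ hc hsp hcap hB
  have hq : 0 ≤ cF * c ^ (B + 3) := by positivity
  have hBp : (cF * c ^ (B + 3)) ^ 2 ≤ (triSitePercolation p).real (σ.corrE P 0 ∩ σ.corrE P 2) := by
    have h := sitePercolation_harris' p (dC 0) (dC 2) (isUpperSet_corrE P σ c0) (isUpperSet_corrE P σ c2)
    unfold triSitePercolation at hC ⊢
    calc (cF * c ^ (B + 3)) ^ 2 = (cF * c ^ (B + 3)) * (cF * c ^ (B + 3)) := sq _
      _ ≤ (sitePercolation (Site 2) p).real (σ.corrE P 0) * (sitePercolation (Site 2) p).real (σ.corrE P 2) :=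
          mul_le_mul (hC 0) (hC 2) hq measureReal_nonneg
      _ ≤ _ := h
  have hBm : (cF * c ^ (B + 3)) ^ 2 ≤ (triSitePercolation p).real (σ.corrE P 1 ∩ σ.corrE P 3) := by
    have h := triSitePercolation_harris_lower p (dC 1) (dC 3) (isLowerSet_corrE P σ c1) (isLowerSet_corrE P σ c3)
    calc (cF * c ^ (B + 3)) ^ 2 = (cF * c ^ (B + 3)) * (cF * c ^ (B + 3)) := sq _
      _ ≤ (triSitePercolation p).real (σ.corrE P 1) * (triSitePercolation p).real (σ.corrE P 3) := mul_le_mul (hC 1) (hC 3) hq measureReal_nonneg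
      _ ≤ _ := h
  -- the move
  have hmove : (σ.armE P 0 ∩ σ.armE P 2) ∩ (σ.armE P 1 ∩ σ.armE P 3) ∩ ((σ.corrE P 0 ∩ σ.corrE P 2) ∩ (σ.corrE P 1 ∩ σ.corrE P 3)) ⊆
      sepFourArmG P.n P.N σ.twq := by
    rintro ω ⟨⟨⟨a0, a2⟩, a1, a3⟩, ⟨b0, b2⟩, b1, b3⟩
    refine move hV hK hR16 hσ hR (fun e => ?_) (fun e => ?_) <;> fin_cases e <;> assumption
  rw [iInter_armE_eq]
  calc (triSitePercolation p).real ((σ.armE P 0 ∩ σ.armE P 2) ∩ (σ.armE P 1 ∩ σ.armE P 3)) * (cF * c ^ (B + 3)) ^ 4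
      = (triSitePercolation p).real ((σ.armE P 0 ∩ σ.armE P 2) ∩ (σ.armE P 1 ∩ σ.armE P 3)) * ((cF * c ^ (B + 3)) ^ 2 * (cF * c ^ (B + 3)) ^ 2) := by ring
    _ ≤ (triSitePercolation p).real ((σ.armE P 0 ∩ σ.armE P 2) ∩ (σ.armE P 1 ∩ σ.armE P 3)) *
          ((triSitePercolation p).real (σ.corrE P 0 ∩ σ.corrE P 2) * (triSitePercolation p).real (σ.corrE P 1 ∩ σ.corrE P 3)) :=
        mul_le_mul_of_nonneg_left (mul_le_mul hBp hBm (by positivity) measureReal_nonneg) measureReal_nonneg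
    _ ≤ (triSitePercolation p).real ((σ.armE P 0 ∩ σ.armE P 2) ∩ (σ.armE P 1 ∩ σ.armE P 3) ∩
          ((σ.corrE P 0 ∩ σ.corrE P 2) ∩ (σ.corrE P 1 ∩ σ.corrE P 3))) := fkg
    _ ≤ (triSitePercolation p).real (sepFourArmG P.n P.N σ.twq) := measureReal_mono hmove (measure_ne_top _ _)

end InSlot4

/-- **The sum over routed inner slots**: for any finite set `S` of slots in range satisfying the routing
predicate, `P_p(⋃_{σ ∈ S} ⋂ₑ armE σ e) · (c_F c^(B+3))⁴ ≤ #S · (P_p(sepFourArmG n N 0) + P_p(sepFourArmG n N 3))`. [cite: Nolin2008, §4.4 (arXiv 0711.4948: proof of Thm. 10, p. 13, "P(Ã^{·/η'}) ≤ C₁(η') P(Ã̃^{·/η',I_{η'}})")] -/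
theorem real_biUnion_arms_le_in {P : LParams} (hV : P.Valid) (hK : 1 ≤ P.K) (hR16 : 16 * P.μ ≤ P.R₀) (p : unitInterval) {cF c : ℝ} {ρ Ncap B : ℕ}
    (hF : ∀ q : unitInterval, (q = p ∨ q = unitInterval.symm p) →
      ∀ (z : Site 2) (k : ℕ), 1 ≤ k → k ≤ Ncap → cF ≤ (triSitePercolation q).real (triFrameAt z k))
    (hrsw : ∀ q : unitInterval, (q = p ∨ q = unitInterval.symm p) →
      ∀ n : ℕ, 1 ≤ ⌊(ρ : ℝ) * n⌋₊ → n ≤ Ncap → c ≤ triLRCrossingProb q ⌊(ρ : ℝ) * n⌋₊ n)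
    (hρ : 128 ≤ ρ) (hc : 0 ≤ c) (hcF : 0 ≤ cF) (hsp : P.iLL 7 + P.μ ≤ ρ * (2 * P.ε)) (hcap : P.n / 8 ≤ Ncap) (hB : P.iGr 0 ≤ B)
    (S : Finset InSlot4) (hS : ∀ σ ∈ S, σ.InRange P ∧ InSlot4.RouteOK P σ) :
    (triSitePercolation p).real (⋃ σ ∈ S, ⋂ e, σ.armE P e) * (cF * c ^ (B + 3)) ^ 4 ≤
      S.card * ((triSitePercolation p).real (sepFourArmG P.n P.N 0) + (triSitePercolation p).real (sepFourArmG P.n P.N 3)) := by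
  classical
  set q := (cF * c ^ (B + 3)) ^ 4 with hq
  set E := (triSitePercolation p).real (sepFourArmG P.n P.N 0) + (triSitePercolation p).real (sepFourArmG P.n P.N 3) with hE
  have hq0 : 0 ≤ q := by positivity
  have hslot : ∀ σ ∈ S, (triSitePercolation p).real (⋂ e, σ.armE P e) * q ≤ E := fun σ hσ => by
    have h := InSlot4.real_arms_le hV hK hR16 (hS σ hσ).1 (hS σ hσ).2 p hF hrsw hρ hc hcF hsp hcap hB
    have h0 : (0 : ℝ) ≤ (triSitePercolation p).real (sepFourArmG P.n P.N 0) := measureReal_nonneg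
    have h3 : (0 : ℝ) ≤ (triSitePercolation p).real (sepFourArmG P.n P.N 3) := measureReal_nonneg
    unfold InSlot4.twq at h
    cases htw : σ.tw
    · rw [htw] at h; simp only [Bool.false_eq_true, ↓reduceIte] at h; linarith
    · rw [htw] at h; simp only [↓reduceIte] at h; linarith
  calc (triSitePercolation p).real (⋃ σ ∈ S, ⋂ e, σ.armE P e) * q
      ≤ (∑ σ ∈ S, (triSitePercolation p).real (⋂ e, σ.armE P e)) * q := mul_le_mul_of_nonneg_right (measureReal_biUnion_finset_le _ _) hq0
    _ = ∑ σ ∈ S, (triSitePercolation p).real (⋂ e, σ.armE P e) * q := Finset.sum_mul _ _ _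
    _ ≤ ∑ _σ ∈ S, E := Finset.sum_le_sum hslot
    _ = S.card * E := by rw [Finset.sum_const, nsmul_eq_mul]

end Literature.Probability.Percolation
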